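import Literature.RingTheory.FormalGroups.HondaTypeFunctionalEquationII
import Literature.NumberTheory.EllipticCurves.FormalGroupFrobeniusTypeProofs
import Literature.NumberTheory.EllipticCurves.FormalGroupInvariantDifferentialProofs
import Literature.NumberTheory.EllipticCurves.FormalGroupLogSummableProofs
import Literature.NumberTheory.EllipticCurves.FormalGroupDictionaryProofs
import Literature.NumberTheory.EllipticCurves.FormalGroupLawAxiomsUniversalProofs
import Literature.NumberTheory.EllipticCurves.FormalGroup
import HarnessLib

/-!
# Route `CyclotomicUntwist`: second-kind series over `ℤ_p` are `p⁻ᵏ·log_W ∘ ψ` with `ψ ∈ Xℤ_p⟦X⟧`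
# (growth of a second-kind series, its Honda type, and Hazewinkel's functional equation lemma (ii))

Cell `pub/bsd-wall` (D-0145 line `route-BirchSwinnertonDyer-CyclotomicUntwist`), prover seat `bsd-line-cycu-p3` (gen 8),
memo `KATZ-FROBENIUS-MOD-VARPI-v2` work packages W1 + W3 (STEP A of the elementary rank-2 route). THEOREMS ONLY (no
definition, no named fact, no `sorry`); helper `--supports` K1 = stmt-BirchSwinnertonDyer-21580. BSD is not proved by this
file and no crux is.

## Setting and results (general odd `p`)

`V/ℤ_p` with elliptic generic fibre `W = V ⊗ ℚ_p` and elliptic special fibre, `F = F_W` the chord–tangent law,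
`a = HasseManin.tr (V ⊗ 𝔽_p)`; `f ∈ Xℚ_p⟦X⟧` is *of the second kind with bound `c`* when `c·(f(F) − f(X) − f(Y)) ∈ ℤ_p⟦X,Y⟧`
(hypothesis `hSK`, coefficientwise `‖·‖ ≤ 1`; Katz's `D(Ĝ/ℤ_p) ⊗ ℚ`).
§1 `exists_norm_natCast_mul_coeff_le` — growth `pʲ·c·n·[Xⁿ]f ∈ ℤ_p` (`∂/∂X₀` of the coboundary at `X₀ = 0` is
`f′·η − f′(0)`, `η = F_X(0,X) = ω⁻¹`). §2 cocycle calculus on `[m]`, `i`, `G_W = F(X^{p²},[p]X)`, `[m](Xᵖ)`.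
§3 `exists_norm_coeff_hondaShift_le_one` — `hondaShift p a (pᵏf) = pᵏ⁻¹(f(X^{p²}) + pf − af(Xᵖ)) ∈ ℤ_p⟦X⟧` (the tree's
`G_V ≡ [a](Xᵖ) (mod p)` read through `f` by the Key lemma `norm_coeff_subst_sub_subst_le_of_natCast_mul_coeff_le`).
§4 `exists_isPadicInt_formalLog_subst_eq` — STEP A: `pᵏf = log_W ∘ ψ`, `ψ = exp_W(pᵏf) ∈ Xℤ_p⟦X⟧`, by the tree's functional
equation lemma (ii) `norm_coeff_le_one_of_subst_eq` (`log_W` and `pᵏf` have the same Honda type `p − aT + T²`).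

[cite: Katz1981CrystallineDieudonne, §5.1 (p. 193) and Thm 5.1.4] [cite: Honda1970, Thm. 2 (p. 223), Thm. 9]
[cite: Hazewinkel1978, Ch. I §2.2 (ii), §2.3] [cite: SilvermanAEC2009, IV.4.3, Thm. V.2.3.1(b)]
-/

set_option autoImplicit false
-- single-conjunct summit: `Summit.BirchSwinnertonDyer.BirchSwinnertonDyer.…` repeats the name by design
set_option linter.dupNamespace false

noncomputable section

open PowerSeries Literature.NumberTheory.EllipticCurves
open Literature.AlgebraicGeometry.Resolution (MvPowerSeries.pderiv MvPowerSeries.coeff_pderiv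
  MvPowerSeries.pderiv_X MvPowerSeries.pderiv_C MvPowerSeries.pderiv_powerSeries_subst
  MvPowerSeries.pderiv_powerSeries_subst_X MvPowerSeries.pderiv_subst_pair)
open Literature.RingTheory.FormalGroups (hondaShift hondaShift_C_mul prime_ne_zero prime_sq_ne_zero
  norm_coeff_le_one_of_subst_eq norm_coeff_subst_sub_subst_le_of_natCast_mul_coeff_le)

namespace Summit.BirchSwinnertonDyer.BirchSwinnertonDyer.Theorems.SecondKindLog

variable {p : ℕ} [hp : Fact p.Prime]

/-! ## §0 Small `p`-adic helpers -/

/-- Ultrametric: `‖a‖ ≤ 1`, `‖b‖ ≤ 1` ⟹ `‖a − b‖ ≤ 1` (the `+` form is `IsUltrametricDist.norm_add_le_max`). [folklore] -/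
theorem norm_sub_le_one {a b : ℚ_[p]} (ha : ‖a‖ ≤ 1) (hb : ‖b‖ ≤ 1) : ‖a - b‖ ≤ 1 := by
  rw [sub_eq_add_neg]; exact (IsUltrametricDist.norm_add_le_max _ _).trans (max_le ha (by rwa [norm_neg]))

/-- `‖pʲ·x‖ ≤ 1` when `‖x‖ ≤ 1`. [folklore] -/
theorem norm_p_pow_mul_le_one (j : ℕ) {x : ℚ_[p]} (hx : ‖x‖ ≤ 1) : ‖(p : ℚ_[p]) ^ j * x‖ ≤ 1 := by
  rw [norm_mul, norm_pow]
  exact mul_le_one₀ (pow_le_one₀ (norm_nonneg _) (Padic.norm_p_lt_one (p := p)).le) (norm_nonneg _) hx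

/-- Every `p`-adic number becomes integral after multiplication by a power of `p`. [folklore] -/
theorem exists_norm_pow_mul_le_one (a : ℚ_[p]) : ∃ j : ℕ, ‖(p : ℚ_[p]) ^ j * a‖ ≤ 1 := by
  obtain ⟨j, hj⟩ := pow_unbounded_of_one_lt ‖a‖ (show (1 : ℝ) < p by exact_mod_cast hp.out.one_lt)
  refine ⟨j, ?_⟩
  rw [norm_mul, norm_pow, Padic.norm_p, inv_pow, inv_mul_le_iff₀ (pow_pos (by exact_mod_cast hp.out.pos) j), mul_one]
  exact hj.le

/-- `∂/∂Xᵢ` preserves `p`-integrality. [folklore] -/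
theorem isPadicInt_pderiv {σ : Type*} {Φ : MvPowerSeries σ ℚ_[p]} (hΦ : IsPadicInt Φ) (i : σ) :
    IsPadicInt (MvPowerSeries.pderiv i Φ) := fun e ↦ by
  rw [MvPowerSeries.coeff_pderiv, norm_mul]
  have h1 : ‖((e i : ℚ_[p]) + 1)‖ ≤ 1 := by
    rw [show ((e i : ℚ_[p]) + 1) = (((e i + 1 : ℕ) : ℤ_[p]) : ℚ_[p]) by push_cast; ring]
    exact PadicInt.norm_le_one _
  exact mul_le_one₀ h1 (norm_nonneg _) (hΦ _)

/-- Substituting a `p`-integral series without constant term keeps `c`-bounded denominators. [folklore] -/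
theorem norm_mul_coeff_subst_le {c : ℚ_[p]} {γ T : ℚ_[p]⟦X⟧} (hγ : ∀ n, ‖c * coeff n γ‖ ≤ 1)
    (hT : IsPadicInt T) (hT0 : constantCoeff T = 0) (n : ℕ) : ‖c * coeff n (γ.subst T)‖ ≤ 1 := by
  have hs : PowerSeries.HasSubst T := PowerSeries.HasSubst.of_constantCoeff_zero' hT0
  have h1 : IsPadicInt (c • γ) := isPadicInt_iff_coeff.mpr fun m ↦ by rw [PowerSeries.coeff_smul, smul_eq_mul]; exact hγ m
  have h2 : IsPadicInt (c • γ.subst T) := by rw [← PowerSeries.subst_smul hs]; exact h1.powerSeries_subst hT hs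
  have := isPadicInt_iff_coeff.mp h2 n
  rwa [PowerSeries.coeff_smul, smul_eq_mul] at this

/-- `expand` keeps `c`-bounded denominators. [folklore] -/
theorem norm_mul_coeff_expand_le {c : ℚ_[p]} {γ : ℚ_[p]⟦X⟧} (hγ : ∀ n, ‖c * coeff n γ‖ ≤ 1)
    (q : ℕ) (hq : q ≠ 0) (n : ℕ) : ‖c * coeff n (expand q hq γ)‖ ≤ 1 := by
  rw [coeff_expand]; split_ifs; exacts [hγ _, by rw [mul_zero, norm_zero]; exact zero_le_one]

/-! ## §1–§2 The cocycle calculus of a second-kind series over `ℚ_p` -/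

section SK

variable (W : WeierstrassCurve ℚ_[p]) (f : ℚ_[p]⟦X⟧)

/-- **`(∂f)(u₁,u₂) = f(F(u₁,u₂)) − f(u₁) − f(u₂)`** — the coboundary, substituted. [folklore] -/
theorem subst_pair_cob {u₁ u₂ : ℚ_[p]⟦X⟧} (h₁ : constantCoeff u₁ = 0) (h₂ : constantCoeff u₂ = 0) :
    MvPowerSeries.subst ![u₁, u₂]
        (f.subst W.formalGroupLaw - f.subst (MvPowerSeries.X 0 : MvPowerSeries (Fin 2) ℚ_[p]) -
          f.subst (MvPowerSeries.X 1 : MvPowerSeries (Fin 2) ℚ_[p])) =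
      f.subst (MvPowerSeries.subst ![u₁, u₂] W.formalGroupLaw) - f.subst u₁ - f.subst u₂ := by
  have hb : MvPowerSeries.HasSubst ![u₁, u₂] := WeierstrassCurve.hasSubst_pair h₁ h₂
  rw [MvPowerSeries.subst_sub hb, MvPowerSeries.subst_sub hb, mvSubst_powerSeries_subst W.hasSubst_formalGroupLaw hb,
    mvSubst_powerSeries_subst (PowerSeries.HasSubst.X 0) hb, mvSubst_powerSeries_subst (PowerSeries.HasSubst.X 1) hb,
    MvPowerSeries.subst_X hb 0, MvPowerSeries.subst_X hb 1]
  rfl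

variable {W f} {c : ℚ_[p]}
  (hSK : ∀ e, ‖c * MvPowerSeries.coeff e
    (f.subst W.formalGroupLaw - f.subst (MvPowerSeries.X 0 : MvPowerSeries (Fin 2) ℚ_[p]) -
      f.subst (MvPowerSeries.X 1 : MvPowerSeries (Fin 2) ℚ_[p]))‖ ≤ 1)
include hSK

/-- **`c·(f(F(u₁,u₂)) − f(u₁) − f(u₂)) ∈ ℤ_p⟦X⟧`** for `u₁, u₂ ∈ Xℤ_p⟦X⟧`. [cite: Katz1981CrystallineDieudonne, §5.1 (p. 193)] -/
theorem norm_mul_coeff_subst_pair_le {u₁ u₂ : ℚ_[p]⟦X⟧} (h₁ : constantCoeff u₁ = 0) (h₂ : constantCoeff u₂ = 0)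
    (hu₁ : IsPadicInt u₁) (hu₂ : IsPadicInt u₂) (n : ℕ) :
    ‖c * coeff n (f.subst (MvPowerSeries.subst ![u₁, u₂] W.formalGroupLaw) - f.subst u₁ - f.subst u₂)‖ ≤ 1 := by
  have hb : MvPowerSeries.HasSubst ![u₁, u₂] := WeierstrassCurve.hasSubst_pair h₁ h₂
  have hG : IsPadicInt (c • (f.subst W.formalGroupLaw - f.subst (MvPowerSeries.X 0 : MvPowerSeries (Fin 2) ℚ_[p]) -
      f.subst (MvPowerSeries.X 1 : MvPowerSeries (Fin 2) ℚ_[p]))) := fun e ↦ by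
    rw [MvPowerSeries.coeff_smul]; exact hSK e
  have h := hG.subst (a := ![u₁, u₂]) (fun s ↦ by fin_cases s <;> assumption) hb
  rw [MvPowerSeries.subst_smul hb, subst_pair_cob W f h₁ h₂] at h
  have := isPadicInt_iff_coeff.mp h n
  rwa [PowerSeries.coeff_smul, smul_eq_mul] at this

/-- **Growth of a second-kind series: `pʲ·c·n·[Xⁿ]f ∈ ℤ_p`.** `∂/∂X₀` of the coboundary at `X₀ = 0` is
`f′(X)·η(X) − f′(0)` with `η = F_X(0, X)`, and `η·ω = 1` with `ω ∈ ℤ_p⟦X⟧` (Katz: `∂f` integral ⟹ `df` integral).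
[cite: Katz1981CrystallineDieudonne, §5.1 (p. 193)] [cite: SilvermanAEC2009, IV.4.3] -/
theorem exists_norm_natCast_mul_coeff_le [hW : W.IsIntegral ℤ_[p]] :
    ∃ j : ℕ, ∀ n : ℕ, ‖(p : ℚ_[p]) ^ j * c * ((n : ℚ_[p]) * coeff n f)‖ ≤ 1 := by
  classical
  set F := W.formalGroupLaw with hF
  set G := f.subst F - f.subst (MvPowerSeries.X 0 : MvPowerSeries (Fin 2) ℚ_[p]) -
    f.subst (MvPowerSeries.X 1 : MvPowerSeries (Fin 2) ℚ_[p]) with hGdef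
  have hG : IsPadicInt (c • G) := fun e ↦ by rw [MvPowerSeries.coeff_smul]; exact hSK e
  have hF0 : MvPowerSeries.constantCoeff F = 0 := W.constantCoeff_formalGroupLaw
  set f' := d⁄dX ℚ_[p] f with hf'
  -- `∂/∂X₀`
  have hd : MvPowerSeries.pderiv 0 G =
      f'.subst F * MvPowerSeries.pderiv 0 F - f'.subst (MvPowerSeries.X 0 : MvPowerSeries (Fin 2) ℚ_[p]) := by
    rw [hGdef, map_sub, map_sub, MvPowerSeries.pderiv_powerSeries_subst hF0, MvPowerSeries.pderiv_powerSeries_subst_X,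
      MvPowerSeries.pderiv_powerSeries_subst_X, if_pos rfl, if_neg (by decide), sub_zero]
  -- `X₀ = 0`, `X₁ = X`
  have hs := WeierstrassCurve.hasSubst_zero_X (R := ℚ_[p])
  have hc1 : constantCoeff f' = coeff 1 f := by
    rw [hf', ← coeff_zero_eq_constantCoeff_apply, coeff_derivative, zero_add, Nat.cast_zero, zero_add, mul_one]
  have hT : MvPowerSeries.subst ![(0 : ℚ_[p]⟦X⟧), PowerSeries.X] (MvPowerSeries.pderiv 0 G) =
      f' * W.formalEta - PowerSeries.C (coeff 1 f) := by
    rw [hd, MvPowerSeries.subst_sub hs, MvPowerSeries.subst_mul hs, mvSubst_powerSeries_subst W.hasSubst_formalGroupLaw hs,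
      W.formalGroupLaw_subst_zero_X, W.subst_zero_X_pderiv_formalGroupLaw, powerSeries_subst_X_self,
      mvSubst_powerSeries_subst (PowerSeries.HasSubst.X 0) hs, WeierstrassCurve.subst_zero_X_X_zero,
      PowerSeries.subst_zero_eq_C_constantCoeff, hc1, MvPowerSeries.map_C]
    rfl
  have h1 : IsPadicInt (c • MvPowerSeries.pderiv 0 G) := by
    rw [← Derivation.map_smul]; exact isPadicInt_pderiv hG 0
  have h2 : IsPadicInt (c • (f' * W.formalEta - PowerSeries.C (coeff 1 f))) := by
    rw [← hT, ← MvPowerSeries.subst_smul hs]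
    exact h1.subst (fun s ↦ by fin_cases s; exacts [IsPadicInt.zero, IsPadicInt.powerSeries_X]) hs
  obtain ⟨j, hj⟩ := exists_norm_pow_mul_le_one (c * coeff 1 f)
  -- `pʲ·c·(f′·η) ∈ ℤ_p⟦X⟧`
  have h3 : IsPadicInt (((p : ℚ_[p]) ^ j * c) • (f' * W.formalEta)) := by
    refine isPadicInt_iff_coeff.mpr fun n ↦ ?_
    have e1 : coeff n ((((p : ℚ_[p]) ^ j * c) • (f' * W.formalEta))) =
        (p : ℚ_[p]) ^ j * (c * coeff n (f' * W.formalEta - PowerSeries.C (coeff 1 f))) +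
          (p : ℚ_[p]) ^ j * c * coeff n (PowerSeries.C (coeff 1 f)) := by
      rw [PowerSeries.coeff_smul, smul_eq_mul, map_sub]; ring
    rw [e1]
    refine (IsUltrametricDist.norm_add_le_max _ _).trans (max_le (norm_p_pow_mul_le_one j ?_) ?_)
    · have := isPadicInt_iff_coeff.mp h2 n
      rwa [PowerSeries.coeff_smul, smul_eq_mul] at this
    · rw [coeff_C]; split_ifs; exacts [by rw [mul_assoc]; exact hj, by rw [mul_zero, norm_zero]; exact zero_le_one]
  -- `η·ω = 1`, `ω ∈ ℤ_p⟦X⟧`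
  have h4 : IsPadicInt (((p : ℚ_[p]) ^ j * c) • f') := by
    have := h3.mul W.isPadicInt_formalOmega
    rwa [smul_mul_assoc, mul_assoc, W.formalEta_mul_formalOmega, mul_one] at this
  refine ⟨j, fun n ↦ ?_⟩
  rcases n with _ | k; · rw [Nat.cast_zero, zero_mul, mul_zero, norm_zero]; exact zero_le_one
  · have := isPadicInt_iff_coeff.mp h4 k
    rw [PowerSeries.coeff_smul, smul_eq_mul, hf', coeff_derivative] at this
    rw [show (p : ℚ_[p]) ^ j * c * (((k + 1 : ℕ) : ℚ_[p]) * coeff (k + 1) f) =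
      (p : ℚ_[p]) ^ j * c * (coeff (k + 1) f * ((k : ℚ_[p]) + 1)) by push_cast; ring]
    exact this

/-- **`c·(f([m]u?) …)`, here `f([m]) − m·f`: `c·(f([m]X) − m f) ∈ ℤ_p⟦X⟧`** (`[m+1] = F([m], X)`, induction).
[cite: Katz1981CrystallineDieudonne, §5.1 (p. 193)] -/
theorem norm_mul_coeff_subst_formalMul_sub_le [hW : W.IsIntegral ℤ_[p]] (hf0 : constantCoeff f = 0) (m n : ℕ) :
    ‖c * coeff n (f.subst (W.formalMul m) - m • f)‖ ≤ 1 := by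
  induction m generalizing n with
  | zero =>
    rw [WeierstrassCurve.formalMul_zero, zero_nsmul, sub_zero, PowerSeries.subst_zero_of_constantCoeff_zero hf0,
      map_zero, mul_zero, norm_zero]; exact zero_le_one
  | succ m ih =>
    have key := norm_mul_coeff_subst_pair_le hSK (W.constantCoeff_formalMul m) constantCoeff_X
      (W.isPadicInt_formalMul m) IsPadicInt.powerSeries_X n
    rw [← WeierstrassCurve.formalMul_succ, powerSeries_subst_X_self] at key
    have e : f.subst (W.formalMul (m + 1)) - (m + 1) • f =
        (f.subst (W.formalMul (m + 1)) - f.subst (W.formalMul m) - f) + (f.subst (W.formalMul m) - m • f) := by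
      rw [succ_nsmul]; ring
    rw [e, map_add, mul_add]
    exact (IsUltrametricDist.norm_add_le_max _ _).trans (max_le key (ih n))

/-- **`c·(f(i(X)) + f) ∈ ℤ_p⟦X⟧`** (`F(X, i(X)) = 0`, `f(0) = 0`). [cite: Katz1981CrystallineDieudonne, §5.1 (p. 193)] -/
theorem norm_mul_coeff_subst_formalNeg_add_le [hW : W.IsIntegral ℤ_[p]] (hf0 : constantCoeff f = 0) (n : ℕ) :
    ‖c * coeff n (f.subst W.formalNeg + f)‖ ≤ 1 := by
  have key := norm_mul_coeff_subst_pair_le hSK constantCoeff_X W.constantCoeff_formalNeg IsPadicInt.powerSeries_X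
    W.isPadicInt_formalNeg n
  rw [W.formalGroupLaw_subst_X_formalNeg', PowerSeries.subst_zero_of_constantCoeff_zero hf0, powerSeries_subst_X_self,
    zero_sub] at key
  rw [show f.subst W.formalNeg + f = -(-f - f.subst W.formalNeg) by ring, map_neg, mul_neg, norm_neg]
  exact key

/-- **`f(G_W) = f(X^{p²}) + p·f + (c⁻¹-integral)`** for `G_W = F(X^{p²}, [p]X)` (`frobLHS`).
[cite: Katz1981CrystallineDieudonne, §5 Thm 5.1.4] -/
theorem exists_subst_frobLHS_eq [hW : W.IsIntegral ℤ_[p]] (hf0 : constantCoeff f = 0) :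
    ∃ β : ℚ_[p]⟦X⟧, (∀ n, ‖c * coeff n β‖ ≤ 1) ∧
      f.subst (WeierstrassCurve.frobLHS p W) = expand (p ^ 2) (prime_sq_ne_zero p) f + p • f + β := by
  have hp0 : p ≠ 0 := hp.out.ne_zero
  have hP : constantCoeff ((X : ℚ_[p]⟦X⟧) ^ p ^ 2) = 0 := by
    rw [map_pow, constantCoeff_X, zero_pow (pow_ne_zero _ hp0)]
  have hPi : IsPadicInt ((X : ℚ_[p]⟦X⟧) ^ p ^ 2) := IsPadicInt.powerSeries_X.pow _
  have hfr : WeierstrassCurve.frobLHS p W = MvPowerSeries.subst ![(X : ℚ_[p]⟦X⟧) ^ p ^ 2, W.formalMul p]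
      W.formalGroupLaw := by rw [WeierstrassCurve.frobLHS, powerSeries_subst_X_self]
  have h1 := norm_mul_coeff_subst_pair_le hSK hP (W.constantCoeff_formalMul p) hPi (W.isPadicInt_formalMul p)
  refine ⟨(f.subst (MvPowerSeries.subst ![(X : ℚ_[p]⟦X⟧) ^ p ^ 2, W.formalMul p] W.formalGroupLaw) -
      f.subst ((X : ℚ_[p]⟦X⟧) ^ p ^ 2) - f.subst (W.formalMul p)) + (f.subst (W.formalMul p) - p • f),
    fun n ↦ ?_, ?_⟩
  · rw [map_add, mul_add]
    exact (IsUltrametricDist.norm_add_le_max _ _).trans (max_le (h1 n) (norm_mul_coeff_subst_formalMul_sub_le hSK hf0 p n))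
  · rw [hfr, PowerSeries.expand_apply]; ring

/-- **`f([m](Xᵖ)) = m·f(Xᵖ) + (c⁻¹-integral)`** (`frobRHSPos`). [cite: Katz1981CrystallineDieudonne, §5 Thm 5.1.4] -/
theorem exists_subst_frobRHSPos_eq [hW : W.IsIntegral ℤ_[p]] (hf0 : constantCoeff f = 0) (m : ℕ) :
    ∃ β : ℚ_[p]⟦X⟧, (∀ n, ‖c * coeff n β‖ ≤ 1) ∧
      f.subst (WeierstrassCurve.frobRHSPos p W m) = m • expand p (prime_ne_zero p) f + β := by
  have hp0 : p ≠ 0 := hp.out.ne_zero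
  have hXp : PowerSeries.HasSubst ((X : ℚ_[p]⟦X⟧) ^ p) := PowerSeries.HasSubst.X_pow hp0
  set γ : ℚ_[p]⟦X⟧ := f.subst (W.formalMul m) - m • f with hγ
  have hγb : ∀ n, ‖c * coeff n γ‖ ≤ 1 := norm_mul_coeff_subst_formalMul_sub_le hSK hf0 m
  refine ⟨expand p (prime_ne_zero p) γ, norm_mul_coeff_expand_le hγb p (prime_ne_zero p), ?_⟩
  rw [WeierstrassCurve.frobRHSPos, ← PowerSeries.subst_comp_subst_apply (W.hasSubst_formalMul m) hXp,
    show f.subst (W.formalMul m) = m • f + γ by rw [hγ]; ring, ← PowerSeries.expand_apply, map_add, map_nsmul]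

/-- **`f(i([m](Xᵖ))) = −m·f(Xᵖ) + (c⁻¹-integral)`** (`frobRHSNeg`). [cite: Katz1981CrystallineDieudonne, §5 Thm 5.1.4] -/
theorem exists_subst_frobRHSNeg_eq [hW : W.IsIntegral ℤ_[p]] (hf0 : constantCoeff f = 0) (m : ℕ) :
    ∃ β : ℚ_[p]⟦X⟧, (∀ n, ‖c * coeff n β‖ ≤ 1) ∧
      f.subst (WeierstrassCurve.frobRHSNeg p W m) = -(m • expand p (prime_ne_zero p) f) + β := by
  have hp0 : p ≠ 0 := hp.out.ne_zero
  obtain ⟨β₁, hβ₁, h₁⟩ := exists_subst_frobRHSPos_eq hSK hf0 m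
  set T := WeierstrassCurve.frobRHSPos p W m with hT
  have hT0 : constantCoeff T = 0 := W.constantCoeff_frobRHSPos p hp0 m
  have hTi : IsPadicInt T := by
    rw [hT, WeierstrassCurve.frobRHSPos]
    exact (W.isPadicInt_formalMul m).powerSeries_subst (IsPadicInt.powerSeries_X.pow _) (PowerSeries.HasSubst.X_pow hp0)
  have hTs : PowerSeries.HasSubst T := PowerSeries.HasSubst.of_constantCoeff_zero' hT0
  set γ : ℚ_[p]⟦X⟧ := f.subst W.formalNeg + f with hγ
  have hγb : ∀ n, ‖c * coeff n γ‖ ≤ 1 := norm_mul_coeff_subst_formalNeg_add_le hSK hf0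
  refine ⟨γ.subst T - β₁, fun n ↦ ?_, ?_⟩
  · rw [map_sub, mul_sub]
    exact norm_sub_le_one (norm_mul_coeff_subst_le hγb hTi hT0 n) (hβ₁ n)
  · rw [WeierstrassCurve.frobRHSNeg, ← WeierstrassCurve.frobRHSPos, ← hT,
      ← PowerSeries.subst_comp_subst_apply (PowerSeries.HasSubst.of_constantCoeff_zero' W.constantCoeff_formalNeg) hTs,
      show f.subst W.formalNeg = γ - f by rw [hγ]; ring, PowerSeries.subst_sub hTs, h₁]; ring

end SK


/-! ## §3 The Frobenius relation: a second-kind series has the Honda type `p − aT + T²` of `log_W` -/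

section Honda

variable (V : WeierstrassCurve ℤ_[p]) [hE : (V.map PadicInt.Coe.ringHom).IsElliptic]
  [hEt : (V.map PadicInt.toZMod).IsElliptic] {f : ℚ_[p]⟦X⟧} (hf0 : constantCoeff f = 0) {d : ℕ}
  (hSK : ∀ e, ‖(p : ℚ_[p]) ^ d * MvPowerSeries.coeff e
    (f.subst (V.map PadicInt.Coe.ringHom).formalGroupLaw - f.subst (MvPowerSeries.X 0 : MvPowerSeries (Fin 2) ℚ_[p]) -
      f.subst (MvPowerSeries.X 1 : MvPowerSeries (Fin 2) ℚ_[p]))‖ ≤ 1)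

include hf0 hSK in
/-- **THE FROBENIUS RELATION / HONDA TYPE OF A SECOND-KIND SERIES.** For `V/ℤ_p` (`p` odd) with elliptic generic and
special fibres, `a = HasseManin.tr (V ⊗ 𝔽_p)`, and `f ∈ Xℚ_p⟦X⟧` whose `F_W`-coboundary has `pᵈ`-bounded denominators:
for some `k`, **`hondaShift p a (pᵏ·f) = pᵏ⁻¹·(f(X^{p²}) + p·f − a·f(Xᵖ)) ∈ ℤ_p⟦X⟧`**, i.e. `pᵏ f` is of Honda type
`p − aT + T²` — Katz's `(φ² − aφ + p)[f] = 0` on `D(Ĝ/ℤ_p) ⊗ ℚ`. Proof: `G_V ≡ R_V (mod p)` (`map_toZMod_frobLHS_sub_eq_zero`,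
from `π² − aπ + p = 0` on `V ⊗ 𝔽_p`), the Key lemma for `pʲ⁺ᵈ f` (growth, §1) and the cocycle calculus (§2).
[cite: Katz1981CrystallineDieudonne, §5 Thm 5.1.4 and (6.1.1)] [cite: SilvermanAEC2009, Thm. V.2.3.1(b)]
[cite: Honda1970, Thm. 9 (proof)] -/
theorem exists_norm_coeff_hondaShift_le_one (hp2 : p ≠ 2) : ∃ k : ℕ, ∀ n : ℕ,
    ‖coeff n (hondaShift p ((Literature.NumberTheory.EllipticCurves.HasseManin.tr (V.map PadicInt.toZMod) : ℤ) : ℚ_[p])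
      (PowerSeries.C ((p : ℚ_[p]) ^ k) * f))‖ ≤ 1 := by
  haveI := V.isIntegral_map_coe
  set W := V.map PadicInt.Coe.ringHom with hWdef
  set a := Literature.NumberTheory.EllipticCurves.HasseManin.tr (V.map PadicInt.toZMod) with hadef
  have hp0 : p ≠ 0 := hp.out.ne_zero
  have hp0' : (p : ℚ_[p]) ≠ 0 := by exact_mod_cast hp0
  -- growth: `g = pʲ⁺ᵈ f` has `n·[Xⁿ]g ∈ ℤ_p`
  obtain ⟨j, hj⟩ := exists_norm_natCast_mul_coeff_le hSK
  set g : ℚ_[p]⟦X⟧ := ((p : ℚ_[p]) ^ j * (p : ℚ_[p]) ^ d) • f with hgdef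
  have hg : ∀ n : ℕ, ‖(n : ℚ_[p]) * coeff n g‖ ≤ 1 := fun n ↦ by
    rw [hgdef, PowerSeries.coeff_smul, smul_eq_mul,
      show (n : ℚ_[p]) * ((p : ℚ_[p]) ^ j * (p : ℚ_[p]) ^ d * coeff n f) =
        (p : ℚ_[p]) ^ j * (p : ℚ_[p]) ^ d * ((n : ℚ_[p]) * coeff n f) by ring]
    exact hj n
  -- the two sides of the Frobenius identity, over `ℤ_p` and over `ℚ_p`
  set Rz : ℤ_[p]⟦X⟧ := if 0 ≤ a then WeierstrassCurve.frobRHSPos p V a.toNat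
    else WeierstrassCurve.frobRHSNeg p V a.natAbs with hRz
  have hmod : (WeierstrassCurve.frobLHS p V - Rz).map PadicInt.toZMod = 0 := V.map_toZMod_frobLHS_sub_eq_zero hp2
  set u : ℚ_[p]⟦X⟧ := (WeierstrassCurve.frobLHS p V).map PadicInt.Coe.ringHom with hu
  set v : ℚ_[p]⟦X⟧ := Rz.map PadicInt.Coe.ringHom with hv
  have huv : ∀ n, ‖coeff n (u - v)‖ ≤ (p : ℝ)⁻¹ := fun n ↦ by
    rw [hu, hv, ← map_sub]
    exact WeierstrassCurve.norm_coeff_map_le_inv_of_map_toZMod hmod n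
  have hint : ∀ (Φ : ℤ_[p]⟦X⟧) (n : ℕ), ‖coeff n (Φ.map (PadicInt.Coe.ringHom (p := p)))‖ ≤ 1 := fun Φ n ↦ by
    rw [coeff_map]; exact PadicInt.norm_le_one _
  have hu0 : constantCoeff u = 0 := by
    rw [hu, ← coeff_zero_eq_constantCoeff, coeff_map, coeff_zero_eq_constantCoeff,
      V.constantCoeff_frobLHS p hp0, map_zero]
  have hv0 : constantCoeff v = 0 := by
    rw [hv, ← coeff_zero_eq_constantCoeff, coeff_map, coeff_zero_eq_constantCoeff, hRz]
    split_ifs; exacts [by rw [V.constantCoeff_frobRHSPos p hp0, map_zero], by rw [V.constantCoeff_frobRHSNeg p hp0, map_zero]]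
  have key := norm_coeff_subst_sub_subst_le_of_natCast_mul_coeff_le hg hu0 (hint _) hv0 (hint _) huv
  -- evaluate `f` on both sides
  have hu' : u = WeierstrassCurve.frobLHS p W := by rw [hu, WeierstrassCurve.map_frobLHS p V _ hp0]
  obtain ⟨β₁, hβ₁, h₁⟩ := exists_subst_frobLHS_eq hSK hf0
  have h₂ : ∃ β₂ : ℚ_[p]⟦X⟧, (∀ n, ‖(p : ℚ_[p]) ^ d * coeff n β₂‖ ≤ 1) ∧
      f.subst v = (a : ℚ_[p]) • expand p (prime_ne_zero p) f + β₂ := by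
    rw [hv, hRz]
    split_ifs with ha
    · obtain ⟨β₂, hβ₂, h⟩ := exists_subst_frobRHSPos_eq hSK hf0 a.toNat
      refine ⟨β₂, hβ₂, ?_⟩
      have hta : ((a.toNat : ℕ) : ℚ_[p]) = (a : ℚ_[p]) := by rw [← Int.cast_natCast, Int.toNat_of_nonneg ha]
      rw [WeierstrassCurve.map_frobRHSPos p V _ hp0, h, ← Nat.cast_smul_eq_nsmul ℚ_[p] a.toNat, hta]
    · obtain ⟨β₂, hβ₂, h⟩ := exists_subst_frobRHSNeg_eq hSK hf0 a.natAbs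
      refine ⟨β₂, hβ₂, ?_⟩
      have hna : ((a.natAbs : ℕ) : ℤ) = -a := by omega
      have hna' : ((a.natAbs : ℕ) : ℚ_[p]) = -(a : ℚ_[p]) := by rw [← Int.cast_natCast, hna, Int.cast_neg]
      rw [WeierstrassCurve.map_frobRHSNeg p V _ hp0, h, ← Nat.cast_smul_eq_nsmul ℚ_[p] a.natAbs, hna', neg_smul, neg_neg]
  obtain ⟨β₂, hβ₂, h₂⟩ := h₂
  set D : ℚ_[p]⟦X⟧ := expand (p ^ 2) (prime_sq_ne_zero p) f + p • f - (a : ℚ_[p]) • expand p (prime_ne_zero p) f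
    with hD
  clear_value D
  have hus : PowerSeries.HasSubst u := PowerSeries.HasSubst.of_constantCoeff_zero' hu0
  have hvs : PowerSeries.HasSubst v := PowerSeries.HasSubst.of_constantCoeff_zero' hv0
  have hfuv : f.subst u - f.subst v = D + β₁ - β₂ := by rw [hu', h₁, h₂, hD]; ring
  have hguv : g.subst u - g.subst v = ((p : ℚ_[p]) ^ j * (p : ℚ_[p]) ^ d) • (f.subst u - f.subst v) := by
    rw [hgdef, PowerSeries.subst_smul hus, PowerSeries.subst_smul hvs, smul_sub]
  refine ⟨j + d + 1, fun n ↦ ?_⟩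
  have e : (p : ℚ_[p]) ^ (j + d) * coeff n D = coeff n (g.subst u - g.subst v) -
      (p : ℚ_[p]) ^ j * ((p : ℚ_[p]) ^ d * coeff n β₁) + (p : ℚ_[p]) ^ j * ((p : ℚ_[p]) ^ d * coeff n β₂) := by
    rw [hguv, PowerSeries.coeff_smul, smul_eq_mul, hfuv, map_sub, map_add, pow_add]; ring
  rw [hondaShift_C_mul, WeierstrassCurve.hondaShift_eq_C_mul, ← hD, coeff_C_mul, coeff_C_mul, pow_succ, mul_assoc,
    mul_inv_cancel_left₀ hp0', e]
  have key' : ‖coeff n (g.subst u - g.subst v)‖ ≤ 1 :=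
    (key n).trans (inv_le_one_of_one_le₀ (by exact_mod_cast hp.out.one_le))
  exact (IsUltrametricDist.norm_add_le_max _ _).trans
    (max_le (norm_sub_le_one key' (norm_p_pow_mul_le_one j (hβ₁ n))) (norm_p_pow_mul_le_one j (hβ₂ n)))

/-! ## §4 STEP A: `pᵏ f = log_W ∘ ψ` with `ψ = exp_W(pᵏ f) ∈ Xℤ_p⟦X⟧` -/

include hf0 hSK in
/-- **STEP A (second kind ⟹ `log_W ∘ (integral)`).** For `V/ℤ_p` (`p` odd) with elliptic generic and special fibres and
`f ∈ Xℚ_p⟦X⟧` whose `F_W`-coboundary has `pᵈ`-bounded denominators, there are `k` and `ψ ∈ Xℤ_p⟦X⟧` with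
**`log_W(ψ) = pᵏ·f`** (namely `ψ = exp_W(pᵏ f)`): `pᵏ f` and `log_W` have the same Honda type `p − aT + T²`
(§3 and the tree's `norm_coeff_hondaShift_formalLog_le_one`), so Hazewinkel's functional equation lemma (ii)
(`norm_coeff_le_one_of_subst_eq`, Honda's strong isomorphism theorem) makes `log_W⁻¹ ∘ (pᵏ f)` integral.
[cite: Honda1970, Thm. 2 (p. 223)] [cite: Hazewinkel1978, Ch. I §2.2 (ii), §2.3] [cite: Katz1981CrystallineDieudonne, §5 Thm 5.1.4] -/
theorem exists_isPadicInt_formalLog_subst_eq (hp2 : p ≠ 2) :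
    ∃ (k : ℕ) (ψ : ℚ_[p]⟦X⟧), IsPadicInt ψ ∧ constantCoeff ψ = 0 ∧
      (V.map PadicInt.Coe.ringHom).formalLog.subst ψ = PowerSeries.C ((p : ℚ_[p]) ^ k) * f := by
  haveI := V.isIntegral_map_coe
  set W := V.map PadicInt.Coe.ringHom with hWdef
  obtain ⟨k, hk⟩ := exists_norm_coeff_hondaShift_le_one V hf0 hSK hp2
  set β : ℚ_[p]⟦X⟧ := PowerSeries.C ((p : ℚ_[p]) ^ k) * f with hβ
  have hβ0 : constantCoeff β = 0 := by rw [hβ, map_mul, hf0, mul_zero]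
  have hβs : PowerSeries.HasSubst β := PowerSeries.HasSubst.of_constantCoeff_zero' hβ0
  have hexp : PowerSeries.HasSubst W.formalExp := PowerSeries.HasSubst.of_constantCoeff_zero' W.constantCoeff_formalExp
  set ψ : ℚ_[p]⟦X⟧ := W.formalExp.subst β with hψ
  have hψ0 : constantCoeff ψ = 0 := constantCoeff_powerSeries_subst_eq_zero hβ0 W.constantCoeff_formalExp
  have hlog : W.formalLog.subst ψ = β := by
    rw [hψ, ← PowerSeries.subst_comp_subst_apply hexp hβs, W.formalLog_subst_formalExp, PowerSeries.subst_X hβs]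
  have ha : ‖((Literature.NumberTheory.EllipticCurves.HasseManin.tr (V.map PadicInt.toZMod) : ℤ) : ℚ_[p])‖ ≤ 1 := by
    rw [show ((Literature.NumberTheory.EllipticCurves.HasseManin.tr (V.map PadicInt.toZMod) : ℤ) : ℚ_[p]) =
      ((Literature.NumberTheory.EllipticCurves.HasseManin.tr (V.map PadicInt.toZMod) : ℤ_[p]) : ℚ_[p]) by simp]
    exact PadicInt.norm_le_one _
  have h1 : ‖coeff 1 W.formalLog‖ = 1 := by rw [W.coeff_one_formalLog, norm_one]
  exact ⟨k, ψ, isPadicInt_iff_coeff.mpr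
    (norm_coeff_le_one_of_subst_eq ha (V.norm_coeff_hondaShift_formalLog_le_one hp2) hk h1 hψ0 hlog), hψ0, hlog⟩

end Honda

end Summit.BirchSwinnertonDyer.BirchSwinnertonDyer.Theorems.SecondKindLog
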